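/-
Copyright: lit-balaban Phase-2 proof seat p09 (gen 6).  Statement-level skeleton of a published paper; no proof claims beyond what the
kernel checks below.
-/
import Literature.MathematicalPhysics.QuantumFieldTheory.BalabanImbrieJaffe1984to88.BIJ85Ineq723TorusCornerGauge
import Literature.MathematicalPhysics.QuantumFieldTheory.BalabanImbrieJaffe1984to88.BIJ85GaugeFnBound513
import Literature.MathematicalPhysics.QuantumFieldTheory.Balaban1983to89.B5Eq112TorusCarriers

/-!
# `BalabanImbrieJaffe1984to88.BIJ85Ineq723Torus` — T. Bałaban, J. Imbrie, A. Jaffe, *Renormalization of the Higgs model: minimizers, propagators and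
the stability of mean field theory*, Commun. Math. Phys. **97** (1985) 299–329 [BalabanImbrieJaffe1985], p. 325 **(7.2.3) `|C^{(k)}_{μν}(x, y)| ≤
Me^{−δ|x−y|}` PROVED WITH NO HYPOTHESIS, ON THE TORI OF THE SERIES, FOR THE (4.3.3) PROPAGATOR OF RECORD** — the actual Δ_k of (4.3.1) on the constraint
subspace `δ(QB)δ_{Ax}(B)` of the series' V1 lattice calculus (`BIJ85Prop521Torus.Wstep`: block averages zero and the CENTRED-tree axial gauge
`LatticeFieldCalculus.IsAxial`) — by transporting file 2's corner-gauge theorem along the block-local regauging between the two axial gauges; with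
(4.3.3) itself (the Gaussian identity, `Z^{(k)} > 0`) for `Wstep`, no hypothesis

statement-level skeleton of published theorems with citation tags; proofs where landed; nothing here is a claim about the Yang–Mills mass gap

PDF held: `paper:balaban1985-cmp97-bij-higgs-minimizers` (journal page = PDF page + 298); pp. 311, 313–315, 325–326 [PDF 13, 15–17, 27–28] read from the
materialised text (`~/.lit/texts/paper-balaban1985-cmp97-bij-higgs-minimizers/p0013.txt`, `p0015.txt`–`p0017.txt`, `p0027.txt`–`p0028.txt`).

THE PRINTED TEXT (verbatim).  p. 311: *"exp(½⟨J, C^{(k)}J⟩) = (Z^{(k)})^{−1}∫𝒟Bδ(QB)δ_{Ax}(B)exp(−½⟨B, Δ_kB⟩ + ⟨B, J⟩). (4.3.3) … C^{(k)} has a kernel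
which decays exponentially, uniformly in k. |C^{(k)}(x, y)| ≤ a exp(−b|x − y|). (4.3.5)"*; p. 325: *"The unit lattice propagator C^{(k)} also has
exponential decay, |C^{(k)}_{μν}(x, y)| ≤ Me^{−δ|x−y|}, (7.2.3) for x, y ∈ T₁^{(k)}. This inequality follows from the bound (2.157) in [6II] and from the
general theorem on unit lattice operators in [7]."*; p. 313: *"PROPOSITION 5.1.1 … H_{k,Ax}B − H_kB = ∂λ. (5.1.1)"*; p. 315: *"λ(x) = λ(A, x) =
−Σ_{j=0}^{k−1} L^{j−k}[(Q_jA)(Γ_{x_{j+1},x_j}) − Q′(Q_jA)(Γ_{x_{j+1},·})]. (5.1.13)"*; p. 326: *"The gauge transformation λ in (5.1.1) is bounded"*.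
[Balaban1984PropagatorsI] p. 19: *"Axial (Ax) gauge fixing conditions A(Γ_{y,x}) = 0, x ∈ B(y), x ≠ y, y ∈ T_L^{(1)} (1.10) … we restrict the gauge
transformations by the condition (Q′λ)(y) = 0"*.

CITATION HEADER (lean-in-tree rule).  Part of the lit-balaban TYPED SKELETON (HOME `run/shared/lean/pub/lit-balaban/`), Phase-2 seat p09 GEN 6, file 3
of the programme «(7.2.3) for the ACTUAL C^{(k)}» (file 1 `BIJ85Eq431DeltaKBridge`: (4.3.1) = [6I] (1.19)/(1.65) Δ_k, kernel decay; file 2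
`BIJ85Ineq723TorusCornerGauge`: (2.153)/(4.3.4)/(2.156)/(7.2.3) with no hypothesis on the constraint subspace `Wcorner` of Bałaban's CORNER-rooted
staircases); rows **C1.Eq7.2.3**, **C1.Eq4.3.4-4.3.5**, **C1.Eq4.3.1-4.3.3** of `HOME/SKELETON.md` (owner r15, referee ref-5); junction rows
**C1.Eq5.1.5-5.1.15** (p08's `BIJ85GaugeFunction5113`/`BIJ85GaugeFnBound513`: the gauge function `λ(A)` and its locality/bounds) and **B5.Eq1.10/1.13**
(p16's `B5Eq112TorusCarriers`: «both axial gauges are complete», `isCompl_axialV1_orbitV1`).  THE POINT OF THIS FILE: the series' V1 calculus roots the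
axial-gauge staircases `Γ_{y,x}` at the block CENTRES (DIVERGENCE F3 of `pub-balaban`; [Balaban1987RG1] (0.1)), [6I]/[6II] and the pub-balaban bond
elimination at the block CORNERS; the two constraint subspaces `Wstep` (seat p30's (5.2.1)/(6.1.1) torus files, the (4.3.3) `W` OF RECORD) and `Wcorner`
(file 2) are DIFFERENT, with different propagators.  They are two slices of the same residual gauge orbits `{∂λ : Q′λ = 0}` (p16), and the curl of the
minimizer `∂H_{k,Ax}` does not see `∂λ` (file 1's `curlOp_Hop_grad`), so the (4.3.3) second moment transports: `C_{Wstep} = T̂C_{Wcorner}T̂^*` with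
`T̂B = B − ∂λ_B`, `λ_B` the one-step gauge function (5.1.12)/(5.1.13) of Prop. 5.1.1 (p08's `fluct`); `T̂` is block-local with bounded entries
(p08's `fluct_eq_zero_of_interior`, `norm_fluct_le` — p. 326 *"the gauge transformation λ in (5.1.1) is bounded"*), so (7.2.3) for `Wcorner` gives
(7.2.3) for `Wstep` by the pub-balaban sandwich lemma (`B6FromB4.sandwich_decay`, [6II] p. 250 *"C is a short-ranged operator"*).  Decls used BY NAME
(nothing restated): file 2 `Wcorner/mem_Wcorner_iff/noZeroModes_corner/ineq723_corner/idx/L_dvd_Mk`; file 1 `curlOp_Hop_grad/pdist_rep_eq_supDist`;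
gen 3 `BIJ85Ineq434Proof.{axialPropagator_galerkin, galerkin_unique, axialPropagator_mem, toEuclideanLin_of_kernel, adjoint_toEuclideanLin}`; gen 2
`BIJ85UnitPropagator433.{unitPropagator, Hop, deltaOp, isUnitPropagator_unitPropagator}`; p30 `BIJ85Prop521Torus.{Wstep, mem_Wstep, toEj, QsE}`;
p08 `BIJ85GaugeFunction5113.fluct/siteAvg_fluct`, `BIJ85Eq5113Proof.fluct_add/fluct_smul`, `BIJ85GaugeFnBound513.norm_fluct_le/
fluct_eq_zero_of_interior`; p16 `B5Eq112TorusCarriers.{axialV1, orbitV1, isCompl_axialV1_orbitV1}`, `B5Eq112RenormTransf.blockConst`; r18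
`LatticeFieldCalculus.{IsAxial, gaugeShift, grad, bondAvg, siteAvg, bondAvg_gaugeShift, supDist}`, `B5HierAxialGaugeV1.isAxial_gaugeShift_iff`;
pub-balaban `B6BondElimination.{IsTree, contour, contour_add_unitVec}`, `B6Elimination.{corner, block}`, `B6LowerBound2153Torus.{toT, rep}`,
`B6Lemma24Torus.block_subset_pbox`, `B6FromB4.sandwich_decay`, `B5Ineq137Torus.T_triangle`/`B3Bound323ZeroTorus.T_eq_supDist`.

WHAT IS PROVED (kernel; `d ≥ 2` where [6II] (2.153) enters, standing range `k + 1 ≤ m + K`; physical normalisation `w = η^d`, `c = η⁻¹ = L^k`):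
* §0 geometry of `T₁^{(k)}`: `supDist_le_of_blockOf_eq` (one block: `≤ L − 1`), `supDist_tgt_le` (a bond: `≤ 1`).
* §1 **the centred regauging** `axialize B = B − ∂(fluct B)`: it IS axial (`isAxial_axialize`), keeps `QB` (`bondAvg_axialize`), moves inside the
  residual orbit (`axialize_sub_mem_orbitV1`); uniqueness of the axial representative in an orbit (`eq_of_isAxial_of_sub_mem_orbitV1`); linearity.
* §2 **the corner regauging** `cornerize B = B − ∂μ⁰_B` (`μ_B(x) = B(Γ_{y,x})` along the CORNER staircase, block mean removed): keeps `QB`, moves inside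
  the orbit, and VANISHES ON THE CORNER-TREE BONDS (`cornerize_tree`, the telescoping `cornerFn_tgt` = pub-balaban `contour_add_unitVec` read on the
  torus labels), whence `cornerize B ∈ Wcorner` when `QB = 0` (`toEj_cornerize_mem_Wcorner`).
* §3 **`T̂ = regauge`** on `CoarseSpace P k`: `∂H_{k,Ax}T̂ = ∂H_{k,Ax}` (`curlHop_regauge`), `T̂(Wcorner) ⊆ Wstep` (`regauge_mem_Wstep`), `T̂ : Wcorner →
  Wstep` ONTO (`exists_regauge_eq`); **no zero modes of `∂H_{k,Ax}` on `Wstep`** (`noZeroModes_step`) and **(4.3.3) holds for the operator formula on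
  `Wstep`, `Z^{(k)} > 0`** (`unitPropagator_step_wellDefined`) — no hypothesis.
* §4 **Galerkin transport** (abstract, any two slices): `axialPropagator_transport` (`C_{W₁}J = G C_{W₂} G^*J` when `TG = T`, `G : W₂ → W₁` onto),
  `kernel_transport` (kernels: `C_{W₁} = M_G C_{W₂} M_Gᵀ`).
* §5 **the matrix of `T̂`**: entries `≤ 1 + 4d(L−1)/2` (`abs_regaugeMat_le`), support `a = b ∨ a₋ ∈ B(b₋′) ∪ B(b₊′)` (`regaugeMat_ne_zero`), range `≤ L`
  (`supDist_le_of_regaugeMat_ne_zero`), row sums `≤ rowBound d L = (1 + 4d(L−1)/2)(1 + 2dL^d)` (`regaugeMat_row_le`) — all uniform in `k` and the volume.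
* §6 **`kernel_step_eq`**: `C_{Wstep}(b, b′) = (T̂ · C_{Wcorner} · T̂ᵀ)(b, b′)`; **(7.2.3)/(4.3.5), no hypothesis**: `ineq723_torus` — ∃ `M, δ > 0` depending on
  `(d, L)` ONLY with `|C^{(k)}(b, b′)| ≤ Me^{−δ·supDist(b₋, b′₋)}` for `C^{(k)} = unitPropagator (V411 P k) (curlOp (η^d) (L^k)) (QsE P k) (Wstep P k)`, every
  torus of these `(d, L)`, every `k + 1 ≤ m + K`, all bonds (`M = M₂e^{2δ₂L}(rowBound d L)²`, `δ = δ₂` from file 2); `ineq723_torus_record` (r15's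
  `KernelData.Ineq723 M δ` for every carrier reading this kernel and `supDist`).
HONEST SCOPE.  (i) Torus (periodic b.c.), U = 1, real abelian fields, `d ≥ 2`; the standing range `k + 1 ≤ m + K` (a next scale exists, so `L` divides the
periods and the blocks tile the torus) is that of files 1–2 and of `Wstep`'s own dictionary lemmas.  (ii) Constants: `(M₂, δ₂)` existential from pv09's
engine through file 2, `rowBound` explicit; no claim of optimality; the uniformity in `k` and in the volume printed on p. 311/p. 325 IS proved (constants
chosen from `(d, L)` before the torus and the scale).  (iii) «Dirichlet boundary conditions outside Λ, uniformly in Λ» (p. 325) is not restated here.  (iv)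
(4.3.4) `‖C^{(k)}‖ ≤ c` on `Wstep` is not restated (file 2 proves it on `Wcorner`; on `Wstep` it follows from (7.2.3) by the Schur test, not typed here).
(v) Nine `def`s with bodies (`axialize`, `axializeL`, `cornerFn`, `cornerFn0`, `cornerize`, `regauge`, `regaugeMat`, `Kcorner`, `rowBound`; one private
pseudo-metric structure), no `def … : Prop`, no new named fact (D-0026).  Unit `lit-balaban-p09` (literature-prover-lit-balaban-p09-g6-0), 2026-08-21.
-/

namespace Literature.MathematicalPhysics.QuantumFieldTheory.BalabanImbrieJaffe1984to88.BIJ85Ineq723Torus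

open Literature.MathematicalPhysics.QuantumFieldTheory.Balaban1983to89
open scoped BigOperators Matrix RealInnerProductSpace
open LatticeFieldCalculus
open BIJ85AxialPropagator411 (BondSpace toE curlOp V411 axialPropagator)
open BIJ85UnitPropagator433 (Hop deltaOp unitPropagator)
open BIJ85Prop521Torus (CoarseSpace toEj QsE Wstep mem_Wstep)
open BIJ85GaugeFunction5113 (fluct siteAvg_fluct siteAvg_sub)
open BIJ85Eq5113Proof (fluct_add fluct_smul)
open BIJ85GaugeFnBound513 (norm_fluct_le fluct_eq_zero_of_interior)
open BIJ85Eq431DeltaKBridge (one_le_Lpow eta_pow_pos Lpow_ne_zero pdist_rep_eq_supDist curlOp_Hop_grad)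
open BIJ85Ineq723TorusCornerGauge (L_dvd_Mk idx idx_fst_coe Wcorner mem_Wcorner_iff noZeroModes_corner ineq723_corner)
open B5Eq112TorusCarriers (axialV1 orbitV1 mem_orbitV1_iff isCompl_axialV1_orbitV1)
open B5Eq112RenormTransf (blockConst siteAvg_blockConst)
open B5Prop11Plancherel (Tor)
open B5Eq117TorusCarriers (Mk)
open B6Lemma24Torus (pbox coarseSites block_subset_pbox)
open B6BondElimination (IsTree unitVec add_unitVec_apply add_unitVec_mem_block contour_add_unitVec not_mem_contour)
open B6LowerBound2153Torus (toT rep rep_toT toT_rep)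

noncomputable section

variable {P : Params} {k : ℕ}

/-! ## §0  Geometry of `T₁^{(k)}`: the `ℓ^∞` torus distance inside a block and across a bond -/

/-- `(idx b).2 = μ`: the direction of the variable of the box is the direction of the bond. [cite: Balaban1984PropagatorsII, (2.152) p.249] -/
theorem idx_snd (b : PBond P k) : (idx P k b).2 = b.dir := rfl

/-- triangle inequality for `supDist` (through pub-balaban's torus distance `T`). [folklore] -/
private theorem supDist_triangle_real (x y z : Balaban1983to89.Site P k) :
    (supDist x z : ℝ) ≤ (supDist x y : ℝ) + (supDist y z : ℝ) := by
  rw [← B3Bound323ZeroTorus.T_eq_supDist, ← B3Bound323ZeroTorus.T_eq_supDist, ← B3Bound323ZeroTorus.T_eq_supDist]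
  exact B5Ineq137Torus.T_triangle P k x y z

/-- two sites of one block are at most `L − 1` apart (blocks are cubes of side `L`, `blockOf` = integer division of the labels by `L`).
[cite: Balaban1987RG1, (0.1) p.252] -/
theorem supDist_le_of_blockOf_eq (hk : k + 1 ≤ P.m + P.K) {x z : Balaban1983to89.Site P k} (h : blockOf x = blockOf z) :
    supDist x z ≤ P.L - 1 := by
  unfold supDist
  refine Finset.sup_le fun μ _ => ?_
  have hq : (x μ).val / P.L = (z μ).val / P.L := by
    rw [← Balaban1983to89.Site.val_blockOf hk x μ, ← Balaban1983to89.Site.val_blockOf hk z μ, h]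
  have hL := P.L_pos
  have h1 := Nat.div_add_mod (x μ).val P.L
  have h2 := Nat.div_add_mod (z μ).val P.L
  have h3 := Nat.mod_lt (x μ).val hL
  have h4 := Nat.mod_lt (z μ).val hL
  rcases le_total (z μ).val (x μ).val with hle | hle
  · calc min (x μ - z μ).val (z μ - x μ).val ≤ (x μ - z μ).val := min_le_left _ _
      _ = (x μ).val - (z μ).val := ZMod.val_sub hle
      _ ≤ P.L - 1 := by rw [hq] at h1; omega
  · calc min (x μ - z μ).val (z μ - x μ).val ≤ (z μ - x μ).val := min_le_right _ _
      _ = (z μ).val - (x μ).val := ZMod.val_sub hle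
      _ ≤ P.L - 1 := by rw [hq] at h1; omega

/-- the two endpoints of a bond are at distance `≤ 1`. [cite: Balaban1982Higgs1, (1.3) p.604] -/
theorem supDist_tgt_le (b : PBond P k) : supDist b.src b.tgt ≤ 1 := by
  unfold supDist
  refine Finset.sup_le fun μ _ => ?_
  by_cases hμ : μ = b.dir
  · subst hμ
    rw [PBond.tgt, Balaban1983to89.Site.shift, Function.update_self]
    calc min (b.src b.dir - (b.src b.dir + 1)).val (b.src b.dir + 1 - b.src b.dir).val
        ≤ (b.src b.dir + 1 - b.src b.dir).val := min_le_right _ _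
      _ = (1 : ZMod (P.sitesPerDir k)).val := by rw [add_sub_cancel_left]
      _ ≤ 1 := by rw [ZMod.val_one_eq_one_mod]; exact Nat.mod_le _ _
  · rw [PBond.tgt, Balaban1983to89.Site.shift, Function.update_of_ne hμ, sub_self, ZMod.val_zero, Nat.zero_min]
    exact Nat.zero_le _

/-- the bonds of `T₁^{(k)}` with the `ℓ^∞` torus distance of their sources as a pseudo-metric space (used inside proofs only, to apply
the sandwich lemma `B6FromB4.sandwich_decay` of the pub-balaban cell). [folklore] -/
@[reducible] private def bondPMS (P : Params) (k : ℕ) : PseudoMetricSpace (PBond P k) where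
  dist b b' := (supDist b.src b'.src : ℝ)
  dist_self b := by
    show (supDist b.src b.src : ℝ) = 0
    rw [(B3TorusRadialSums.supDist_eq_zero_iff _ _).2 rfl, Nat.cast_zero]
  dist_comm b b' := by
    show (supDist b.src b'.src : ℝ) = (supDist b'.src b.src : ℝ)
    rw [B3TorusRadialSums.supDist_comm]
  dist_triangle b b' b'' := supDist_triangle_real _ _ _

/-! ## §1  The V1 (centred-tree) axial regauging `B ↦ B − ∂λ_B`, `λ_B = fluct B` ([BalabanImbrieJaffe1985] (5.1.12): the contour functional
minus its block mean) -/

/-- **the regauging into the centred axial gauge**: `axialize B = B − ∂(fluct B)`, `fluct B (z) = B(Γ_{z₊,z}) − Q′(B(Γ_{z₊,·}))` the bracket of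
(5.1.12) — the one-step (`k = 1`) instance of the gauge function `λ(A)` of (5.1.13). [cite: BalabanImbrieJaffe1985, (5.1.12) p.315] -/
def axialize (A : VecField P k ℝ) : VecField P k ℝ := gaugeShift 1 (fluct A) A

/-- `(axialize B)(b) = B(b) − (λ_B(b₊) − λ_B(b₋))`. [cite: BalabanImbrieJaffe1985, (5.1.12) p.315] -/
theorem axialize_apply (A : VecField P k ℝ) (b : PBond P k) : axialize A b = A b - (fluct A b.tgt - fluct A b.src) := by
  simp only [axialize, gaugeShift, grad, one_smul]

/-- `axialize B − B = −∂λ_B`. [cite: BalabanImbrieJaffe1985, (5.1.1) p.313] -/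
theorem axialize_sub (A : VecField P k ℝ) : axialize A - A = -grad 1 (fluct A) := by
  funext b
  simp only [axialize, gaugeShift, Pi.sub_apply, Pi.neg_apply]
  ring

/-- **`axialize B` IS in the centred axial gauge** `δ_{Ax}` (`LatticeFieldCalculus.IsAxial`): the spanning half of p16's
`B5Eq112TorusCarriers.isCompl_axialV1_orbitV1`, made explicit. [cite: Balaban1984PropagatorsI, (1.10) p.19] -/
theorem isAxial_axialize (hk : k + 1 ≤ P.m + P.K) (A : VecField P k ℝ) : IsAxial (axialize A) := by
  unfold axialize
  rw [B5HierAxialGaugeV1.isAxial_gaugeShift_iff one_ne_zero]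
  intro y r
  simp only [fluct, BIJ85GaugeFunction5113.contour, Balaban1983to89.Site.blockOf_blockSite hk, Balaban1983to89.Site.blockOf_emb hk, stairSum_self, inv_one, one_smul]
  ring

/-- a gauge shift by the zero function is the identity. [cite: Balaban1984PropagatorsI, (1.4) p.18] -/
private theorem gaugeShift_zero_fn {j : ℕ} (c : ℝ) (B : VecField P j ℝ) : gaugeShift c (0 : SiteField P j ℝ) B = B := by
  funext b
  simp [gaugeShift, grad]

/-- **the regauging preserves the block averages**: `Q(axialize B) = QB` (by (1.20) `Q(B − ∂λ) = QB − ∂Q′λ` and `Q′λ_B = 0`).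
[cite: Balaban1984PropagatorsI, (1.20) p.20] -/
theorem bondAvg_axialize (hk : k + 1 ≤ P.m + P.K) (A : VecField P k ℝ) : bondAvg (axialize A) = bondAvg A := by
  unfold axialize
  rw [bondAvg_gaugeShift hk, siteAvg_fluct hk, gaugeShift_zero_fn]

/-- `axialize B − B` is a residual gauge direction `∂λ`, `Q′λ = 0`. [cite: Balaban1984PropagatorsI, (1.13) p.19] -/
theorem axialize_sub_mem_orbitV1 (hk : k + 1 ≤ P.m + P.K) (A : VecField P k ℝ) : axialize A - A ∈ orbitV1 P k := by
  rw [axialize_sub]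
  exact (orbitV1 P k).neg_mem ((mem_orbitV1_iff _).2 ⟨fluct A, siteAvg_fluct hk A, rfl⟩)

/-- **uniqueness of the axial representative in a residual orbit**: two centred-axial fields differing by `∂λ`, `Q′λ = 0`, are equal
(`axialV1 ⊓ orbitV1 = ⊥`, p16). [cite: Balaban1984PropagatorsI, (1.13) p.19] -/
theorem eq_of_isAxial_of_sub_mem_orbitV1 (hk : k + 1 ≤ P.m + P.K) {A B : VecField P k ℝ} (hA : IsAxial A) (hB : IsAxial B)
    (h : A - B ∈ orbitV1 P k) : A = B := by
  have h1 : A - B ∈ axialV1 P k := (axialV1 P k).sub_mem hA hB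
  have h2 : A - B ∈ axialV1 P k ⊓ orbitV1 P k := Submodule.mem_inf.2 ⟨h1, h⟩
  rw [(isCompl_axialV1_orbitV1 hk).inf_eq_bot, Submodule.mem_bot] at h2
  exact sub_eq_zero.1 h2

/-- `axialize` is additive (`λ(A)` is linear in `A`, (5.1.14)). [cite: BalabanImbrieJaffe1985, (5.1.14) p.315] -/
theorem axialize_add (A B : VecField P k ℝ) : axialize (A + B) = axialize A + axialize B := by
  funext b
  simp only [axialize_apply, Pi.add_apply, fluct_add]
  ring

/-- `axialize` is homogeneous. [cite: BalabanImbrieJaffe1985, (5.1.14) p.315] -/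
theorem axialize_smul (c : ℝ) (A : VecField P k ℝ) : axialize (c • A) = c • axialize A := by
  funext b
  simp only [axialize_apply, Pi.smul_apply, fluct_smul, smul_eq_mul]
  ring

/-- `axialize` as a linear map. [cite: BalabanImbrieJaffe1985, (5.1.14) p.315] -/
def axializeL (P : Params) (k : ℕ) : VecField P k ℝ →ₗ[ℝ] VecField P k ℝ where
  toFun := axialize
  map_add' := axialize_add
  map_smul' := axialize_smul

/-! ## §2  The corner-tree regauging `B ↦ B − ∂μ_B` into Bałaban's gauge `B(Γ_{y,x}) = 0`, staircases from the block CORNERS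
([Balaban1984PropagatorsI] (1.6)–(1.7), (1.10); pub-balaban `B6BondElimination.IsTree`) -/

/-- the corner staircase functional `μ_B(x) = B(Γ_{y,x})`, `y` the CORNER of the block of `x`, `Γ_{y,x}` the staircase of [6I] (1.7) (pub-balaban
`B6BondElimination.contour` on the integer labels `rep x` of the torus). [cite: Balaban1984PropagatorsI, (1.7) p.18] -/
def cornerFn (A : VecField P k ℝ) : SiteField P k ℝ := fun x =>
  ∑ e ∈ B6BondElimination.contour P.L (B6Elimination.corner P.L (rep (Mk P k) x)) (rep (Mk P k) x), A ⟨toT (Mk P k) e.1, e.2⟩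

/-- the corner gauge function with its block mean removed (so that `Q′μ = 0`). [cite: Balaban1984PropagatorsI, (1.13) p.19] -/
def cornerFn0 (A : VecField P k ℝ) : SiteField P k ℝ := cornerFn A - blockConst (siteAvg (cornerFn A))

/-- **the regauging into Bałaban's corner-tree axial gauge**: `cornerize B = B − ∂μ⁰_B`. [cite: Balaban1984PropagatorsI, (1.10) p.19] -/
def cornerize (A : VecField P k ℝ) : VecField P k ℝ := gaugeShift 1 (cornerFn0 A) A

/-- `Q′μ⁰_B = 0`. [cite: Balaban1984PropagatorsI, (1.13) p.19] -/
theorem siteAvg_cornerFn0 (hk : k + 1 ≤ P.m + P.K) (A : VecField P k ℝ) : siteAvg (cornerFn0 A) = 0 := by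
  unfold cornerFn0
  rw [siteAvg_sub, siteAvg_blockConst hk, sub_self]

/-- `cornerize B − B = −∂μ⁰_B ∈ {∂λ : Q′λ = 0}`. [cite: Balaban1984PropagatorsI, (1.13) p.19] -/
theorem cornerize_sub_mem_orbitV1 (hk : k + 1 ≤ P.m + P.K) (A : VecField P k ℝ) : cornerize A - A ∈ orbitV1 P k := by
  have h : cornerize A - A = -grad 1 (cornerFn0 A) := by
    funext b
    simp only [cornerize, gaugeShift, Pi.sub_apply, Pi.neg_apply]
    ring
  rw [h]
  exact (orbitV1 P k).neg_mem ((mem_orbitV1_iff _).2 ⟨cornerFn0 A, siteAvg_cornerFn0 hk A, rfl⟩)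

/-- `Q(cornerize B) = QB`. [cite: Balaban1984PropagatorsI, (1.20) p.20] -/
theorem bondAvg_cornerize (hk : k + 1 ≤ P.m + P.K) (A : VecField P k ℝ) : bondAvg (cornerize A) = bondAvg A := by
  unfold cornerize
  rw [bondAvg_gaugeShift hk, siteAvg_cornerFn0 hk, gaugeShift_zero_fn]

/-- geometry of a corner-tree bond `⟨z, z + e_μ⟩` (`IsTree`): its target has the integer label `rep z + e_μ` (no wrap-around), in the same block.
[cite: Balaban1984PropagatorsI, (1.7) p.18] -/
theorem rep_tgt_of_isTree (hk : k + 1 ≤ P.m + P.K) {b : PBond P k} (hb : IsTree P.L (coarseSites P.L (Mk P k)) (idx P k b)) :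
    rep (Mk P k) b.tgt = rep (Mk P k) b.src + unitVec b.dir ∧
      B6Elimination.corner P.L (rep (Mk P k) b.src + unitVec b.dir) = B6Elimination.corner P.L (rep (Mk P k) b.src) := by
  obtain ⟨hY, h2, -⟩ := hb
  simp only [idx_fst_coe, idx_snd] at hY h2
  have hL := P.L_pos
  have hz : rep (Mk P k) b.src ∈ B6Elimination.block P.L (B6Elimination.corner P.L (rep (Mk P k) b.src)) :=
    B6Elimination.mem_block_corner hL _
  have hz' : rep (Mk P k) b.src + unitVec b.dir ∈ B6Elimination.block P.L (B6Elimination.corner P.L (rep (Mk P k) b.src)) :=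
    add_unitVec_mem_block hz h2
  have hbox : rep (Mk P k) b.src + unitVec b.dir ∈ pbox (Mk P k) := block_subset_pbox (L_dvd_Mk hk) hY hz'
  refine ⟨?_, B6Elimination.corner_eq_of_mem_block hL hz'⟩
  have htgt : b.tgt = toT (Mk P k) (rep (Mk P k) b.src + unitVec b.dir) := by
    funext i
    by_cases hi : i = b.dir
    · subst hi
      rw [PBond.tgt, Balaban1983to89.Site.shift, Function.update_self]
      simp only [toT, Pi.add_apply, B6BondElimination.unitVec_apply, rep, if_true, Int.cast_add, Int.cast_natCast,
        Int.cast_one, ZMod.natCast_zmod_val]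
    · rw [PBond.tgt, Balaban1983to89.Site.shift, Function.update_of_ne hi]
      simp only [toT, Pi.add_apply, B6BondElimination.unitVec_apply, rep, if_neg hi, add_zero, Int.cast_natCast,
        ZMod.natCast_zmod_val]
  rw [htgt, rep_toT (Mk P k) hbox]

/-- a corner-tree bond stays inside its block: `(b₊)′ = (b₋)′` for the V1 block map `blockOf`. [cite: Balaban1984PropagatorsI, (1.7) p.18] -/
theorem blockOf_tgt_of_isTree (hk : k + 1 ≤ P.m + P.K) {b : PBond P k} (hb : IsTree P.L (coarseSites P.L (Mk P k)) (idx P k b)) :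
    blockOf b.tgt = blockOf b.src := by
  obtain ⟨htgt, hcor⟩ := rep_tgt_of_isTree hk hb
  have hL0 : (P.L : ℤ) ≠ 0 := by exact_mod_cast P.L_pos.ne'
  funext i
  apply ZMod.val_injective
  rw [Balaban1983to89.Site.val_blockOf hk, Balaban1983to89.Site.val_blockOf hk]
  have h1 : ((b.tgt i).val : ℤ) = ((b.src i).val : ℤ) + unitVec b.dir i := by
    have := congr_fun htgt i
    simpa only [rep, Pi.add_apply] using this
  have h2 := congr_fun hcor i
  simp only [B6Elimination.corner_apply, Pi.add_apply, rep] at h2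
  have h3 := mul_left_cancel₀ hL0 h2
  have h4 : (((b.tgt i).val / P.L : ℕ) : ℤ) = (((b.src i).val / P.L : ℕ) : ℤ) := by
    rw [Int.natCast_div, Int.natCast_div, h1]
    exact h3
  exact_mod_cast h4

/-- **the telescoping of (1.10) along the corner tree**: for a tree bond `b = ⟨z, z + e_μ⟩`, `Γ_{y,z+e_μ} = Γ_{y,z} ∪ {b}`, whence
`μ_B(b₊) = B(b) + μ_B(b₋)` (pub-balaban `contour_add_unitVec`). [cite: Balaban1984PropagatorsI, (1.10) p.19] -/
theorem cornerFn_tgt (hk : k + 1 ≤ P.m + P.K) (A : VecField P k ℝ) {b : PBond P k}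
    (hb : IsTree P.L (coarseSites P.L (Mk P k)) (idx P k b)) : cornerFn A b.tgt = A b + cornerFn A b.src := by
  obtain ⟨htgt, hcor⟩ := rep_tgt_of_isTree hk hb
  obtain ⟨-, -, h1⟩ := hb
  simp only [idx_fst_coe, idx_snd] at h1
  have hz : rep (Mk P k) b.src ∈ B6Elimination.block P.L (B6Elimination.corner P.L (rep (Mk P k) b.src)) :=
    B6Elimination.mem_block_corner P.L_pos _
  unfold cornerFn
  rw [htgt, hcor, contour_add_unitVec hz h1, Finset.sum_insert (not_mem_contour _ _ _)]
  congr 1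
  show A ⟨toT (Mk P k) (rep (Mk P k) b.src), b.dir⟩ = A b
  rw [toT_rep]

/-- **`cornerize B` vanishes on the corner-tree bonds** (`B(Γ_{y,x}) = 0` for Bałaban's staircases). [cite: Balaban1984PropagatorsI, (1.10) p.19] -/
theorem cornerize_tree (hk : k + 1 ≤ P.m + P.K) (A : VecField P k ℝ) {b : PBond P k}
    (hb : IsTree P.L (coarseSites P.L (Mk P k)) (idx P k b)) : cornerize A b = 0 := by
  have ht := cornerFn_tgt hk A hb
  have hbl := blockOf_tgt_of_isTree hk hb
  simp only [cornerize, gaugeShift, grad, cornerFn0, Pi.sub_apply, blockConst, hbl, ht, one_smul]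
  ring

/-- **`cornerize B ∈ Wcorner` when `QB = 0`** (file 2's `mem_Wcorner_iff`: `QB = 0` and vanishing on the tree bonds).
[cite: Balaban1984PropagatorsII, (2.153) p.249] -/
theorem toEj_cornerize_mem_Wcorner (hk : k + 1 ≤ P.m + P.K) {A : VecField P k ℝ} (hA : bondAvg A = 0) :
    toEj P k (cornerize A) ∈ Wcorner P k := by
  rw [mem_Wcorner_iff hk]
  refine ⟨?_, fun p hp => ?_⟩
  · show bondAvg (cornerize A) = 0
    rw [bondAvg_cornerize hk, hA]
  · show cornerize A ((idx P k).symm p) = 0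
    apply cornerize_tree hk A
    rw [Equiv.apply_symm_apply]
    exact hp

/-! ## §3  The regauging map `T̂` on the unit-lattice bond fields: `Wcorner → Wstep` onto, `∂H_{k,Ax}T̂ = ∂H_{k,Ax}` -/

/-- **`T̂`**: the V1 axial regauging as a linear operator on `CoarseSpace P k = ℝ^{bonds}`. [cite: BalabanImbrieJaffe1985, (5.1.1) p.313] -/
def regauge (P : Params) (k : ℕ) : CoarseSpace P k →ₗ[ℝ] CoarseSpace P k :=
  (toEj P k).toLinearMap ∘ₗ axializeL P k ∘ₗ (toEj P k).symm.toLinearMap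

/-- unfolding `T̂`. [cite: BalabanImbrieJaffe1985, (5.1.1) p.313] -/
theorem regauge_apply (x : CoarseSpace P k) : regauge P k x = toEj P k (axialize ((toEj P k).symm x)) := rfl

/-- `T̂` on a bond field. [cite: BalabanImbrieJaffe1985, (5.1.1) p.313] -/
theorem regauge_toEj (A : VecField P k ℝ) : regauge P k (toEj P k A) = toEj P k (axialize A) := by
  rw [regauge_apply, LinearEquiv.symm_apply_apply]

/-- `T̂x = x − ∂λ_x`. [cite: BalabanImbrieJaffe1985, (5.1.1) p.313] -/
theorem regauge_eq_sub (x : CoarseSpace P k) : regauge P k x = x - toEj P k (grad 1 (fluct ((toEj P k).symm x))) := by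
  have h : axialize ((toEj P k).symm x) = (toEj P k).symm x - grad 1 (fluct ((toEj P k).symm x)) := rfl
  rw [regauge_apply, h, map_sub, LinearEquiv.apply_symm_apply]

/-- **`∂H_{k,Ax}T̂ = ∂H_{k,Ax}`**: the curl of the minimizer does not see a gauge shift of the data (file 1's `curlOp_Hop_grad`: `δ_k(∂λ′) = 0`).
[cite: BalabanImbrieJaffe1985, (4.3.1) p.311] -/
theorem curlHop_regauge (hk : k ≤ P.m + P.K) {w : ℝ} (hw : 0 < w) {c : ℝ} (hc : c ≠ 0) (x : CoarseSpace P k) :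
    curlOp (P := P) w c (Hop (V411 P k) (curlOp (P := P) w c) (QsE P k) (regauge P k x)) =
      curlOp (P := P) w c (Hop (V411 P k) (curlOp (P := P) w c) (QsE P k) x) := by
  rw [regauge_eq_sub, map_sub, map_sub, curlOp_Hop_grad hk hw hc 1, sub_zero]

/-- **`T̂(Wcorner) ⊆ Wstep`**: the regauged field is centred-axial with the same (vanishing) block averages.
[cite: BalabanImbrieJaffe1985, (4.3.3) p.311] -/
theorem regauge_mem_Wstep (hk : k + 1 ≤ P.m + P.K) (v : Wcorner P k) : regauge P k (v : CoarseSpace P k) ∈ Wstep P k := by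
  obtain ⟨hQ, -⟩ := (mem_Wcorner_iff hk (v : CoarseSpace P k)).1 v.2
  have hv : (v : CoarseSpace P k) = toEj P k ((toEj P k).symm (v : CoarseSpace P k)) := ((toEj P k).apply_symm_apply _).symm
  rw [hv, regauge_toEj, mem_Wstep, LinearEquiv.symm_apply_apply]
  exact ⟨by rw [bondAvg_axialize hk]; exact hQ, isAxial_axialize hk _⟩

/-- **`T̂ : Wcorner → Wstep` is ONTO**: a field of `Wstep` is `T̂` of its corner regauging (the two axial gauges are two slices of the same residual
orbits `{∂λ : Q′λ = 0}`, p16's `isCompl_axialV1_orbitV1`). [cite: Balaban1984PropagatorsI, (1.13) p.19] -/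
theorem exists_regauge_eq (hk : k + 1 ≤ P.m + P.K) (w : Wstep P k) :
    ∃ v : Wcorner P k, regauge P k (v : CoarseSpace P k) = (w : CoarseSpace P k) := by
  obtain ⟨hQ, hAx⟩ := (mem_Wstep k (w : CoarseSpace P k)).1 w.2
  refine ⟨⟨toEj P k (cornerize ((toEj P k).symm (w : CoarseSpace P k))), toEj_cornerize_mem_Wcorner hk hQ⟩, ?_⟩
  show regauge P k (toEj P k (cornerize ((toEj P k).symm (w : CoarseSpace P k)))) = (w : CoarseSpace P k)
  rw [regauge_toEj]
  have h : axialize (cornerize ((toEj P k).symm (w : CoarseSpace P k))) = (toEj P k).symm (w : CoarseSpace P k) := by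
    refine eq_of_isAxial_of_sub_mem_orbitV1 hk (isAxial_axialize hk _) hAx ?_
    have h1 := (orbitV1 P k).add_mem (axialize_sub_mem_orbitV1 hk (cornerize ((toEj P k).symm (w : CoarseSpace P k))))
      (cornerize_sub_mem_orbitV1 hk ((toEj P k).symm (w : CoarseSpace P k)))
    rwa [sub_add_sub_cancel] at h1
  rw [h, LinearEquiv.apply_symm_apply]

/-- **no zero modes of `∂H_{k,Ax}` on `Wstep`** (from file 2's `noZeroModes_corner` through `T̂`), on the tori, no hypothesis; `d ≥ 2`.
[cite: BalabanImbrieJaffe1985, (4.3.4) p.311] -/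
theorem noZeroModes_step (hd : 2 ≤ P.d) (hk : k + 1 ≤ P.m + P.K) (w : Wstep P k)
    (hw : curlOp (P := P) (P.eta k ^ P.d) ((P.L : ℝ) ^ k)
      (Hop (V411 P k) (curlOp (P := P) (P.eta k ^ P.d) ((P.L : ℝ) ^ k)) (QsE P k) (w : CoarseSpace P k)) = 0) : w = 0 := by
  obtain ⟨v, hv⟩ := exists_regauge_eq hk w
  have h1 : curlOp (P := P) (P.eta k ^ P.d) ((P.L : ℝ) ^ k)
      (Hop (V411 P k) (curlOp (P := P) (P.eta k ^ P.d) ((P.L : ℝ) ^ k)) (QsE P k) (v : CoarseSpace P k)) = 0 := by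
    rw [← curlHop_regauge (by omega) (eta_pow_pos P k P.d) (Lpow_ne_zero P k), hv, hw]
  have h2 := noZeroModes_corner hd hk v h1
  exact (Submodule.coe_eq_zero (x := w)).1 (by rw [← hv, h2, Submodule.coe_zero, map_zero])

/-- **(4.3.3) HOLDS FOR THE OPERATOR FORMULA ON `Wstep`, and `Z^{(k)} > 0`**, on the tori, no hypothesis (`d ≥ 2`, `k + 1 ≤ m + K`): the Gaussian
source identity `exp(½⟨J, C^{(k)}J⟩) = (Z^{(k)})⁻¹∫_{Wstep} exp(−½⟨B, Δ_kB⟩ + ⟨B, J⟩)dB` of gen 2's `isUnitPropagator_unitPropagator` with its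
no-zero-modes hypothesis discharged. [cite: BalabanImbrieJaffe1985, (4.3.3) p.311] -/
theorem unitPropagator_step_wellDefined (hd : 2 ≤ P.d) (hk : k + 1 ≤ P.m + P.K) :
    BIJ85UnitPropagator433.IsUnitPropagator (Wstep P k)
        (deltaOp (V411 P k) (curlOp (P := P) (P.eta k ^ P.d) ((P.L : ℝ) ^ k)) (QsE P k))
        (unitPropagator (V411 P k) (curlOp (P := P) (P.eta k ^ P.d) ((P.L : ℝ) ^ k)) (QsE P k) (Wstep P k)) ∧
      0 < BIJ85UnitPropagator433.unitZ (Wstep P k) (deltaOp (V411 P k) (curlOp (P := P) (P.eta k ^ P.d) ((P.L : ℝ) ^ k)) (QsE P k)) :=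
  BIJ85UnitPropagator433.isUnitPropagator_unitPropagator _ _ _ _ fun w hw => noZeroModes_step hd hk w hw

/-! ## §4  Galerkin transport: `C_{W₁} = G C_{W₂} G^*` whenever `TG = T` and `G` maps `W₂` onto `W₁` -/

section Transport

variable {E₁ F' : Type*} [NormedAddCommGroup E₁] [InnerProductSpace ℝ E₁] [FiniteDimensional ℝ E₁]
  [NormedAddCommGroup F'] [InnerProductSpace ℝ F'] [FiniteDimensional ℝ F']

/-- **transport of the (4.3.3)-type second moment between two gauge slices**: if `G` maps the constraint subspace `W₂` ONTO `W₁` and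
`TG = T` (a regauging the curl does not see), then `C_{W₁}J = G C_{W₂} G^*J` — the Galerkin equation of `W₂` at the source `G^*J` pushes forward to
that of `W₁` at `J` (uniqueness: no zero modes on `W₁`, which follows from those on `W₂`). [cite: BalabanImbrieJaffe1985, (4.3.3) p.311] -/
theorem axialPropagator_transport {W₁ W₂ : Submodule ℝ E₁} {T : E₁ →ₗ[ℝ] F'} (G : E₁ →ₗ[ℝ] E₁)
    (hT₂ : ∀ w : W₂, T (w : E₁) = 0 → w = 0) (hTG : ∀ x, T (G x) = T x)
    (hG₂ : ∀ w : W₂, G (w : E₁) ∈ W₁) (hG₁ : ∀ w : W₁, ∃ v : W₂, G (v : E₁) = (w : E₁)) (J : E₁) :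
    axialPropagator W₁ T J = G (axialPropagator W₂ T (LinearMap.adjoint G J)) := by
  have hT₁ : ∀ w : W₁, T (w : E₁) = 0 → w = 0 := fun w hw => by
    obtain ⟨v, hv⟩ := hG₁ w
    have h1 : T (v : E₁) = 0 := by rw [← hTG, hv, hw]
    have h2 := hT₂ v h1
    exact (Submodule.coe_eq_zero (x := w)).1 (by rw [← hv, h2, Submodule.coe_zero, map_zero])
  have hu₂ := BIJ85Ineq434Proof.axialPropagator_mem W₂ T (LinearMap.adjoint G J)
  refine BIJ85Ineq434Proof.galerkin_unique hT₁ (BIJ85Ineq434Proof.axialPropagator_mem W₁ T J) (hG₂ ⟨_, hu₂⟩)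
    (fun v => BIJ85Ineq434Proof.axialPropagator_galerkin hT₁ J v) fun v => ?_
  obtain ⟨v₂, hv₂⟩ := hG₁ v
  rw [← hv₂, hTG, hTG, BIJ85Ineq434Proof.axialPropagator_galerkin hT₂ (LinearMap.adjoint G J) v₂, LinearMap.adjoint_inner_right]

end Transport

section TransportKernel

variable {n : Type} [Fintype n] [DecidableEq n]
  {F' : Type*} [NormedAddCommGroup F'] [InnerProductSpace ℝ F'] [FiniteDimensional ℝ F']

/-- **the kernel form of the transport**: `C_{W₁}(p, q) = (M_G · C_{W₂} · M_Gᵀ)(p, q)` with `M_G(p, q) = (Gδ_q)(p)` the matrix of `G` and `C_{W₂}(p, q)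
= (C_{W₂}δ_q)(p)`. [cite: BalabanImbrieJaffe1985, (4.3.5) p.311] -/
theorem kernel_transport {W₁ W₂ : Submodule ℝ (EuclideanSpace ℝ n)} {T : EuclideanSpace ℝ n →ₗ[ℝ] F'}
    (G : EuclideanSpace ℝ n →ₗ[ℝ] EuclideanSpace ℝ n)
    (hT₂ : ∀ w : W₂, T (w : EuclideanSpace ℝ n) = 0 → w = 0) (hTG : ∀ x, T (G x) = T x)
    (hG₂ : ∀ w : W₂, G (w : EuclideanSpace ℝ n) ∈ W₁)
    (hG₁ : ∀ w : W₁, ∃ v : W₂, G (v : EuclideanSpace ℝ n) = (w : EuclideanSpace ℝ n)) (p q : n) :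
    axialPropagator W₁ T (EuclideanSpace.single q 1) p =
      (Matrix.of (fun p q => G (EuclideanSpace.single q 1) p) *
          Matrix.of (fun p q => axialPropagator W₂ T (EuclideanSpace.single q 1) p) *
        (Matrix.of fun p q => G (EuclideanSpace.single q 1) p)ᵀ) p q := by
  have hG : G = Matrix.toEuclideanLin (Matrix.of fun p q => G (EuclideanSpace.single q 1) p) :=
    (BIJ85Ineq434Proof.toEuclideanLin_of_kernel G).symm
  have hC : axialPropagator W₂ T = Matrix.toEuclideanLin (Matrix.of fun p q => axialPropagator W₂ T (EuclideanSpace.single q 1) p) :=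
    (BIJ85Ineq434Proof.toEuclideanLin_of_kernel _).symm
  rw [axialPropagator_transport G hT₂ hTG hG₂ hG₁]
  generalize (Matrix.of fun p q => G (EuclideanSpace.single q 1) p) = MG at hG
  generalize (Matrix.of fun p q => axialPropagator W₂ T (EuclideanSpace.single q 1) p) = K₂ at hC
  rw [hC, hG, BIJ85Ineq434Proof.adjoint_toEuclideanLin]
  simp only [Matrix.toLpLin_apply, PiLp.ofLp_single, Matrix.mulVec_mulVec, Matrix.mulVec_single_one, PiLp.toLp_apply]
  rfl

end TransportKernel

/-! ## §5  The matrix of `T̂`: entries, support (range `≤ L`), row sums — uniformly in `k` and in the volume -/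

/-- the matrix of `T̂` in the bond basis, `M(b, a) = (T̂δ_a)(b)`. [cite: BalabanImbrieJaffe1985, (5.1.1) p.313] -/
def regaugeMat (P : Params) (k : ℕ) [DecidableEq (PBond P k)] : Matrix (PBond P k) (PBond P k) ℝ :=
  Matrix.of fun b a => regauge P k (EuclideanSpace.single a 1) b

/-- the kernel of file 2's corner-gauge propagator as a matrix, `K(a, a′) = (C_{Wcorner}δ_{a′})(a)`. [cite: BalabanImbrieJaffe1985, (4.3.5) p.311] -/
def Kcorner (P : Params) (k : ℕ) [DecidableEq (PBond P k)] : Matrix (PBond P k) (PBond P k) ℝ :=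
  Matrix.of fun a a' => unitPropagator (V411 P k) (curlOp (P := P) (P.eta k ^ P.d) ((P.L : ℝ) ^ k)) (QsE P k) (Wcorner P k)
    (EuclideanSpace.single a' 1) a

/-- the bonds issued from one block: `d·L^d` of them. [cite: Balaban1987RG1, (0.3) p.252] -/
private theorem card_filter_src_le (hk : k + 1 ≤ P.m + P.K) (y : Balaban1983to89.Site P (k + 1)) :
    (Finset.univ.filter fun a : PBond P k => blockOf a.src = y).card ≤ P.d * P.L ^ P.d := by
  calc (Finset.univ.filter fun a : PBond P k => blockOf a.src = y).card
      ≤ (Balaban1983to89.block y ×ˢ (Finset.univ : Finset (Fin P.d))).card :=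
        Finset.card_le_card_of_injOn (fun a => (a.src, a.dir))
          (fun a ha => by
            have ha' := (Finset.mem_filter.1 (Finset.mem_coe.1 ha)).2
            rw [Finset.mem_coe, Finset.mem_product]
            exact ⟨by unfold Balaban1983to89.block; exact Finset.mem_filter.2 ⟨Finset.mem_univ _, ha'⟩, Finset.mem_univ _⟩)
          (fun a _ a' _ hh => by
            rcases a with ⟨s, μ⟩
            rcases a' with ⟨s', μ'⟩
            simp only [Prod.mk.injEq] at hh
            obtain ⟨rfl, rfl⟩ := hh
            rfl)
    _ = P.d * P.L ^ P.d := by rw [Finset.card_product, Balaban1983to89.Site.card_block hk, Finset.card_univ, Fintype.card_fin, mul_comm]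

/-- the bonds ending in one block: at most `d·L^d` of them. [cite: Balaban1987RG1, (0.3) p.252] -/
private theorem card_filter_tgt_le (hk : k + 1 ≤ P.m + P.K) (y : Balaban1983to89.Site P (k + 1)) :
    (Finset.univ.filter fun a : PBond P k => blockOf a.tgt = y).card ≤ P.d * P.L ^ P.d := by
  calc (Finset.univ.filter fun a : PBond P k => blockOf a.tgt = y).card
      ≤ (Balaban1983to89.block y ×ˢ (Finset.univ : Finset (Fin P.d))).card :=
        Finset.card_le_card_of_injOn (fun a => (a.tgt, a.dir))
          (fun a ha => by
            have ha' := (Finset.mem_filter.1 (Finset.mem_coe.1 ha)).2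
            rw [Finset.mem_coe, Finset.mem_product]
            exact ⟨by unfold Balaban1983to89.block; exact Finset.mem_filter.2 ⟨Finset.mem_univ _, ha'⟩, Finset.mem_univ _⟩)
          (fun a _ a' _ hh => by
            rcases a with ⟨s, μ⟩
            rcases a' with ⟨s', μ'⟩
            simp only [Prod.mk.injEq] at hh
            obtain ⟨h1, rfl⟩ := hh
            have h3 : s = s' := (shiftEquiv μ).injective h1
            subst h3
            rfl)
    _ = P.d * P.L ^ P.d := by rw [Finset.card_product, Balaban1983to89.Site.card_block hk, Finset.card_univ, Fintype.card_fin, mul_comm]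

/-- the row/column-sum constant of `T̂`: `(1 + 4d(L−1)/2)(1 + 2dL^d)`. [cite: BalabanImbrieJaffe1985, (7.2.4) p.326] -/
def rowBound (d L : ℕ) : ℝ := (1 + 4 * ((d * ((L - 1) / 2) : ℕ) : ℝ)) * (1 + 2 * ((d * L ^ d : ℕ) : ℝ))

/-- `0 < rowBound d L` (the constant of (7.2.3) below is positive). [cite: BalabanImbrieJaffe1985, (7.2.3) p.325] -/
theorem rowBound_pos (d L : ℕ) : 0 < rowBound d L := by unfold rowBound; positivity

section Mat

variable [DecidableEq (PBond P k)]

/-- unfolding `Kcorner`. [cite: BalabanImbrieJaffe1985, (4.3.5) p.311] -/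
theorem Kcorner_apply (a a' : PBond P k) :
    Kcorner P k a a' = unitPropagator (V411 P k) (curlOp (P := P) (P.eta k ^ P.d) ((P.L : ℝ) ^ k)) (QsE P k) (Wcorner P k)
      (EuclideanSpace.single a' 1) a := rfl

/-- **the entries of `T̂`**: `M(b, a) = δ_a(b) − (λ_{δ_a}(b₊) − λ_{δ_a}(b₋))`. [cite: BalabanImbrieJaffe1985, (5.1.12) p.315] -/
theorem regaugeMat_apply (b a : PBond P k) :
    regaugeMat P k b a = (Pi.single a (1 : ℝ) : VecField P k ℝ) b -
      (fluct (Pi.single a (1 : ℝ) : VecField P k ℝ) b.tgt - fluct (Pi.single a (1 : ℝ) : VecField P k ℝ) b.src) := by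
  show axialize (WithLp.ofLp (EuclideanSpace.single a (1 : ℝ))) b = _
  rw [PiLp.ofLp_single]
  exact axialize_apply _ b

/-- the basis field is bounded by `1`. [folklore] -/
private theorem norm_single_le (a b : PBond P k) : ‖(Pi.single a (1 : ℝ) : VecField P k ℝ) b‖ ≤ 1 := by
  rw [Pi.single_apply]
  split_ifs <;> simp

/-- **`|M(b, a)| ≤ 1 + 4·d·((L−1)/2)`** (the (5.1.12) bracket is bounded by `2d(L−1)/2·sup|B|`, p08's `norm_fluct_le`). [cite: BalabanImbrieJaffe1985, (5.1.12) p.315] -/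
theorem abs_regaugeMat_le (hk : k + 1 ≤ P.m + P.K) (b a : PBond P k) :
    |regaugeMat P k b a| ≤ 1 + 4 * ((P.d * ((P.L - 1) / 2) : ℕ) : ℝ) := by
  rw [regaugeMat_apply]
  have h0 : |(Pi.single a (1 : ℝ) : VecField P k ℝ) b| ≤ 1 := by
    have := norm_single_le a b; rwa [Real.norm_eq_abs] at this
  have h1 : ∀ z, |fluct (Pi.single a (1 : ℝ) : VecField P k ℝ) z| ≤ 2 * ((P.d * ((P.L - 1) / 2) : ℕ) : ℝ) * 1 := fun z => by
    have := norm_fluct_le hk (Pi.single a (1 : ℝ) : VecField P k ℝ) (norm_single_le a) z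
    rwa [Real.norm_eq_abs] at this
  calc |(Pi.single a (1 : ℝ) : VecField P k ℝ) b -
          (fluct (Pi.single a (1 : ℝ) : VecField P k ℝ) b.tgt - fluct (Pi.single a (1 : ℝ) : VecField P k ℝ) b.src)|
      ≤ |(Pi.single a (1 : ℝ) : VecField P k ℝ) b| +
          (|fluct (Pi.single a (1 : ℝ) : VecField P k ℝ) b.tgt| + |fluct (Pi.single a (1 : ℝ) : VecField P k ℝ) b.src|) :=
        (abs_sub _ _).trans (add_le_add le_rfl (abs_sub _ _))
    _ ≤ 1 + (2 * ((P.d * ((P.L - 1) / 2) : ℕ) : ℝ) * 1 + 2 * ((P.d * ((P.L - 1) / 2) : ℕ) : ℝ) * 1) :=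
        add_le_add h0 (add_le_add (h1 _) (h1 _))
    _ = 1 + 4 * ((P.d * ((P.L - 1) / 2) : ℕ) : ℝ) := by ring

/-- **the support of `T̂`** (locality of `λ(A)`, p08's `fluct_eq_zero_of_interior`): `M(b, a) ≠ 0` only if `a = b` or `a₋` lies in the block of
`b₋` or of `b₊`. [cite: BalabanImbrieJaffe1985, (7.2.4) p.326] -/
theorem regaugeMat_ne_zero (hk : k + 1 ≤ P.m + P.K) {b a : PBond P k} (h : regaugeMat P k b a ≠ 0) :
    a = b ∨ blockOf a.src = blockOf b.src ∨ blockOf a.src = blockOf b.tgt := by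
  by_contra hc
  push Not at hc
  obtain ⟨h1, h2, h3⟩ := hc
  apply h
  have hz : ∀ z : Balaban1983to89.Site P k, blockOf a.src ≠ blockOf z → fluct (Pi.single a (1 : ℝ) : VecField P k ℝ) z = 0 :=
    fun z hz => fluct_eq_zero_of_interior hk z fun b' hb' _ => by
      rw [Pi.single_apply]
      split_ifs with hab
      · exact absurd (hab ▸ hb') hz
      · rfl
  rw [regaugeMat_apply, hz b.src h2, hz b.tgt h3, Pi.single_apply, if_neg (Ne.symm h1)]
  ring

/-- **the range of `T̂` is `≤ L`**: `M(b, a) ≠ 0 ⟹ |b₋ − a₋|_∞ ≤ L`. [cite: BalabanImbrieJaffe1985, (7.2.4) p.326] -/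
theorem supDist_le_of_regaugeMat_ne_zero (hk : k + 1 ≤ P.m + P.K) {b a : PBond P k} (h : regaugeMat P k b a ≠ 0) :
    supDist b.src a.src ≤ P.L := by
  have hL := P.L_pos
  rcases regaugeMat_ne_zero hk h with h1 | h1 | h1
  · rw [h1, (B3TorusRadialSums.supDist_eq_zero_iff _ _).2 rfl]
    exact Nat.zero_le _
  · exact (supDist_le_of_blockOf_eq hk h1.symm).trans (Nat.sub_le _ _)
  · have h2 := supDist_le_of_blockOf_eq hk h1.symm
    have h3 := supDist_tgt_le b
    have h4 : (supDist b.src a.src : ℝ) ≤ (supDist b.src b.tgt : ℝ) + (supDist b.tgt a.src : ℝ) := supDist_triangle_real _ _ _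
    have h5 : supDist b.src a.src ≤ supDist b.src b.tgt + supDist b.tgt a.src := by exact_mod_cast h4
    omega

/-- **the rows of `T̂` are summable uniformly**: `Σ_a |M(b, a)| ≤ (1 + 4d(L−1)/2)(1 + 2dL^d)`. [cite: BalabanImbrieJaffe1985, (7.2.4) p.326] -/
theorem regaugeMat_row_le (hk : k + 1 ≤ P.m + P.K) (b : PBond P k) : ∑ a, |regaugeMat P k b a| ≤ rowBound P.d P.L := by
  classical
  set S : Finset (PBond P k) := {b} ∪ (Finset.univ.filter fun a : PBond P k => blockOf a.src = blockOf b.src) ∪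
    (Finset.univ.filter fun a : PBond P k => blockOf a.src = blockOf b.tgt) with hS
  have hmem : ∀ a, regaugeMat P k b a ≠ 0 → a ∈ S := fun a ha => by
    rw [hS, Finset.mem_union, Finset.mem_union, Finset.mem_singleton, Finset.mem_filter, Finset.mem_filter]
    rcases regaugeMat_ne_zero hk ha with h | h | h
    · exact Or.inl (Or.inl h)
    · exact Or.inl (Or.inr ⟨Finset.mem_univ _, h⟩)
    · exact Or.inr ⟨Finset.mem_univ _, h⟩
  have hcard : (S.card : ℝ) ≤ 1 + 2 * ((P.d * P.L ^ P.d : ℕ) : ℝ) := by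
    have h1 := card_filter_src_le hk (blockOf b.src)
    have h2 := card_filter_src_le hk (blockOf b.tgt)
    have h3 : S.card ≤ 1 + P.d * P.L ^ P.d + P.d * P.L ^ P.d := by
      rw [hS]
      refine (Finset.card_union_le _ _).trans (add_le_add ((Finset.card_union_le _ _).trans (add_le_add ?_ h1)) h2)
      rw [Finset.card_singleton]
    have h4 : (S.card : ℝ) ≤ ((1 + P.d * P.L ^ P.d + P.d * P.L ^ P.d : ℕ) : ℝ) := by exact_mod_cast h3
    refine h4.trans (le_of_eq ?_)
    push_cast
    ring
  have key : ∀ a, |regaugeMat P k b a| ≤ if a ∈ S then 1 + 4 * ((P.d * ((P.L - 1) / 2) : ℕ) : ℝ) else 0 := fun a => by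
    by_cases ha : a ∈ S
    · rw [if_pos ha]; exact abs_regaugeMat_le hk b a
    · rw [if_neg ha]
      have : regaugeMat P k b a = 0 := by
        by_contra hne
        exact ha (hmem a hne)
      rw [this, abs_zero]
  have h0 : (0 : ℝ) ≤ 1 + 4 * ((P.d * ((P.L - 1) / 2) : ℕ) : ℝ) := by positivity
  calc ∑ a, |regaugeMat P k b a| ≤ ∑ a, (if a ∈ S then 1 + 4 * ((P.d * ((P.L - 1) / 2) : ℕ) : ℝ) else 0) :=
        Finset.sum_le_sum fun a _ => key a
    _ = S.card * (1 + 4 * ((P.d * ((P.L - 1) / 2) : ℕ) : ℝ)) := by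
        rw [Finset.sum_ite_mem, Finset.univ_inter, Finset.sum_const, nsmul_eq_mul]
    _ ≤ (1 + 2 * ((P.d * P.L ^ P.d : ℕ) : ℝ)) * (1 + 4 * ((P.d * ((P.L - 1) / 2) : ℕ) : ℝ)) :=
        mul_le_mul_of_nonneg_right hcard h0
    _ = rowBound P.d P.L := by rw [rowBound, mul_comm]

end Mat

/-! ## §6  (2.156)-transport and (7.2.3)/(4.3.5) FOR THE (4.3.3) PROPAGATOR ON `Wstep`, ON THE TORI, NO HYPOTHESIS -/

/-- **THE KERNEL OF `C^{(k)}` ON `Wstep` IS `T̂ · C_{Wcorner} · T̂ᵀ`** (`d ≥ 2`, `k + 1 ≤ m + K`). [cite: BalabanImbrieJaffe1985, (4.3.5) p.311] -/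
theorem kernel_step_eq [DecidableEq (PBond P k)] (hd : 2 ≤ P.d) (hk : k + 1 ≤ P.m + P.K) (b b' : PBond P k) :
    unitPropagator (V411 P k) (curlOp (P := P) (P.eta k ^ P.d) ((P.L : ℝ) ^ k)) (QsE P k) (Wstep P k)
        (EuclideanSpace.single b' 1) b =
      (regaugeMat P k * Kcorner P k * (regaugeMat P k)ᵀ) b b' := by
  unfold Kcorner regaugeMat unitPropagator
  exact kernel_transport (W₁ := Wstep P k) (W₂ := Wcorner P k) (regauge P k)
    (fun w hw => noZeroModes_corner hd hk w hw)
    (fun x => by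
      simp only [LinearMap.comp_apply]
      exact curlHop_regauge (by omega) (eta_pow_pos P k P.d) (Lpow_ne_zero P k) x)
    (fun w => regauge_mem_Wstep hk w) (fun w => exists_regauge_eq hk w) b b'

/-- **(7.2.3) = (4.3.5) ON THE TORI FOR THE (4.3.3) PROPAGATOR OF RECORD, WITH NO HYPOTHESIS** — p. 325 [PDF 27]: *"The unit lattice propagator
C^{(k)} also has exponential decay, |C^{(k)}_{μν}(x, y)| ≤ Me^{−δ|x−y|}, (7.2.3) for x, y ∈ T₁^{(k)}. This inequality follows from the bound (2.157) in
[6II] and from the general theorem on unit lattice operators in [7]."* — for `C^{(k)} = unitPropagator (V411 P k) (curlOp (η^d) (L^k)) (QsE P k)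
(Wstep P k)`, the (4.3.3) propagator of the ACTUAL action Δ_k of (4.3.1) on the constraint subspace `δ(QB)δ_{Ax}(B)` of the series' V1 calculus
(`BIJ85Prop521Torus.Wstep`: `QB = 0` and `LatticeFieldCalculus.IsAxial`, centred blocks — the `W` of seat p30's (5.2.1)/(6.1.1) torus files):
there are `M, δ > 0` DEPENDING ON `d` AND `L` ONLY with `|C^{(k)}_{μν}(x, y)| ≤ Me^{−δ|x−y|}` (`|x − y|` = `supDist` of `T₁^{(k)}`) for every torus
`Setup` with these `d ≥ 2`, `L`, every `k + 1 ≤ m + K`, all bonds — uniformly in `k` and in the volume.  Chain, all proved: file 2's `ineq723_corner`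
(the corner gauge; (2.153), (2.156), Sect. 5 of [7] inside) → `kernel_step_eq` (`C_{Wstep} = T̂C_{Wcorner}T̂ᵀ`) → the locality of `T̂` (§5) and the
pub-balaban sandwich lemma `B6FromB4.sandwich_decay`; `M = M₂e^{2δ₂L}m²`, `δ = δ₂`, `m = rowBound d L`. [cite: BalabanImbrieJaffe1985, (7.2.3) p.325] -/
theorem ineq723_torus (d L : ℕ) (hd : 2 ≤ d) :
    ∃ M δ : ℝ, 0 < M ∧ 0 < δ ∧ ∀ (P : Params), P.d = d → P.L = L → ∀ (k : ℕ) (_ : DecidableEq (PBond P k)),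
      k + 1 ≤ P.m + P.K → ∀ b b' : PBond P k,
        |unitPropagator (V411 P k) (curlOp (P := P) (P.eta k ^ P.d) ((P.L : ℝ) ^ k)) (QsE P k) (Wstep P k)
            (EuclideanSpace.single b' 1) b| ≤ M * Real.exp (-(δ * (supDist b.src b'.src : ℝ))) := by
  obtain ⟨M₂, δ₂, hM, hδ, H⟩ := ineq723_corner d L hd
  refine ⟨M₂ * Real.exp (2 * δ₂ * L) * rowBound d L * rowBound d L, δ₂,
    by have := rowBound_pos d L; positivity, hδ, fun P hP hPL k _ hk b b' => ?_⟩
  subst hP hPL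
  rw [kernel_step_eq hd hk]
  letI : PseudoMetricSpace (PBond P k) := bondPMS P k
  have hdist : ∀ a a' : PBond P k, dist a a' = (supDist a.src a'.src : ℝ) := fun _ _ => rfl
  have hD : ∀ a a' : PBond P k, |Kcorner P k a a'| ≤ M₂ * Real.exp (-(δ₂ * dist a a')) := fun a a' => by
    rw [hdist, Kcorner_apply]
    exact H P rfl rfl k _ hk a a'
  have hrange : ∀ i u : PBond P k, regaugeMat P k i u ≠ 0 → dist i u ≤ (P.L : ℝ) := fun i u h => by
    rw [hdist]
    exact_mod_cast supDist_le_of_regaugeMat_ne_zero hk h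
  have hrange' : ∀ v j : PBond P k, (regaugeMat P k)ᵀ v j ≠ 0 → dist v j ≤ (P.L : ℝ) := fun v j h => by
    rw [dist_comm]
    exact hrange j v h
  have hrow : ∀ i : PBond P k, ∑ u, |regaugeMat P k i u| ≤ rowBound P.d P.L := fun i => regaugeMat_row_le hk i
  have hcol : ∀ j : PBond P k, ∑ v, |(regaugeMat P k)ᵀ v j| ≤ rowBound P.d P.L := fun j => by
    simp only [Matrix.transpose_apply]
    exact hrow j
  have h := B6FromB4.sandwich_decay (fun a : PBond P k => a) (fun a : PBond P k => a) (regaugeMat P k) (Kcorner P k)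
    (regaugeMat P k)ᵀ hM.le hδ.le hrange hrow hrange' hcol hD b b'
  rw [hdist] at h
  exact h

/-- **(7.2.3) IN THE RECORD FORM OF THE SKELETON** (r15's `BIJ85Sect7Statements.KernelData.Ineq723`): for every Sect. 7.2 kernel carrier whose
`C^{(k)}_{μν}(x, y)` is the kernel of the torus propagator on `Wstep` at the bonds `⟨x, μ⟩`, `⟨y, ν⟩` and whose `|x − y|` is `supDist` of `T₁^{(k)}`,
`Kd.Ineq723 M δ` holds with the `(d, L)`-dependent constants of `ineq723_torus`, every `k + 1 ≤ m + K`. [cite: BalabanImbrieJaffe1985, (7.2.3) p.325] -/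
theorem ineq723_torus_record (d L : ℕ) (hd : 2 ≤ d) :
    ∃ M δ : ℝ, 0 < M ∧ 0 < δ ∧ ∀ (P : Params), P.d = d → P.L = L → ∀ (k : ℕ) (_ : DecidableEq (PBond P k)),
      k + 1 ≤ P.m + P.K → ∀ (Kd : BIJ85Sect7Statements.KernelData) (site : Kd.SiteU → Balaban1983to89.Site P k)
        (dir : Kd.Dir → Fin P.d),
        (∀ μ ν x y, Kd.C μ ν x y =
          unitPropagator (V411 P k) (curlOp (P := P) (P.eta k ^ P.d) ((P.L : ℝ) ^ k)) (QsE P k) (Wstep P k)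
            (EuclideanSpace.single (⟨site y, dir ν⟩ : PBond P k) 1) ⟨site x, dir μ⟩) →
        (∀ x y, Kd.distU x y = (supDist (site x) (site y) : ℝ)) → Kd.Ineq723 M δ := by
  obtain ⟨M, δ, hM, hδ, H⟩ := ineq723_torus d L hd
  refine ⟨M, δ, hM, hδ, fun P hP hPL k _ hk Kd site dir hC hdist μ ν x y => ?_⟩
  rw [hC, hdist]
  exact H P hP hPL k _ hk ⟨site x, dir μ⟩ ⟨site y, dir ν⟩

end

end Literature.MathematicalPhysics.QuantumFieldTheory.BalabanImbrieJaffe1984to88.BIJ85Ineq723Torus
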